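import Summits.Parity.GeneralizedHardyLittlewood.Theorems.RelativeDimOne.Negative.RelativeDimOneLoadBearing
import HarnessLib

/-!
# `RelativeDimOne` (stmt-Parity-14113): the absolute slack must exceed `log N`

Negative lemma for the crux `LeeYangFibres.RelativeDimOne` (cdisprove seat, cycle 1), part 4 (vocabulary
`lin` from part 1 `RelativeDimOneLoadBearing`). Part 2 shows that the absolute slack `+ εN` of the error
`ε(β_∞𝔖 + N)` cannot be dropped (`not_purelyRelativeDimOne`, a discrepancy of size `1`). Here the cheap
quantitative sharpening: `not_relativeDimOneLogSlack` — the strengthening with error `ε(β_∞𝔖 + log N)` is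
FALSE. Witness `t = 1`, `ψ(n) = n`, `K = {(p)}` the single point at a prime `p ∈ (N/2, N]` (Bertrand,
Mathlib `Nat.exists_prime_lt_and_le_two_mul`): `S = Λ(p) = log p > ½ log N` while `β_∞({(p)}) = 0`, so at
`ε = ½` the inequality `log p ≤ ½ log N` fails. Hence the least absolute slack `g(N)` for which
`|S − β_∞𝔖| ≤ ε(β_∞𝔖 + g(N))` can hold uniformly lies above `log N` (in truth above every `log^A N` by Maier's
irregularity theorem for primes in intervals of length `log^A x`, 1985 — not formalised; whether `N^δ`
suffices for every `δ > 0` is open even at `t = 1`). Tools: the one-point body `ptAt m`, its lattice points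
(`filter_ptAt`), `S(n; {(p)}) = Λ(p)` (`vonMangoldtSum_id_ptAt`), `β_∞({(m)}) = 0` (`archFactor_ptAt`).
[folklore]
-/

noncomputable section

open scoped BigOperators Classical Topology
open Finset Filter MeasureTheory Set Literature.NumberTheory.Sieve
open Summit.Parity.GeneralizedHardyLittlewood.Theses.LeeYangFibres (RelativeDimOne DimOne)

namespace Summit.Parity.GeneralizedHardyLittlewood.Theorems.RelativeDimOne.Negative

/-! ## §B1′ The absolute slack must exceed `log N`: slack `ε·log N` is FALSE -/

/-- The one-point body `{(m)} ⊆ ℝ¹`. -/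
def ptAt (m : ℤ) : Set (Fin 1 → ℝ) := {fun _ => (m : ℝ)}

/-- A singleton is convex. -/
theorem convex_ptAt (m : ℤ) : Convex ℝ (ptAt m) := convex_singleton _

/-- `{(m)} ⊆ [-N, N]` for `|m| ≤ N`. -/
theorem ptAt_subset_realBox {m : ℤ} {N : ℕ} (h1 : -(N : ℤ) ≤ m) (h2 : m ≤ N) : ptAt m ⊆ realBox 1 N := by
  intro x hx
  rw [ptAt, Set.mem_singleton_iff] at hx
  subst hx
  have h1' : -(N : ℝ) ≤ m := by exact_mod_cast h1
  have h2' : (m : ℝ) ≤ N := by exact_mod_cast h2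
  simp only [realBox, Set.mem_Icc, Pi.le_def, Fin.forall_fin_one]
  exact ⟨h1', h2'⟩

/-- The lattice points with real point `(m)` are exactly `{(m)}` (for `|m| ≤ N`). -/
theorem filter_ptAt {m : ℤ} {N : ℕ} (h1 : -(N : ℤ) ≤ m) (h2 : m ≤ N) :
    (latticeBox 1 N).filter (fun n => realPoint n ∈ ptAt m) = {fun _ => m} := by
  ext n
  simp only [Finset.mem_filter, Finset.mem_singleton, ptAt, Set.mem_singleton_iff, latticeBox,
    Fintype.mem_piFinset, Finset.mem_Icc]
  constructor
  · rintro ⟨-, h⟩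
    funext i
    have hi := congr_fun h i
    simp only [realPoint] at hi
    exact_mod_cast hi
  · rintro rfl
    exact ⟨fun _ => ⟨h1, h2⟩, funext fun _ => by simp [realPoint]⟩

/-- `S(n; {(p)}, N) = Λ(p)` for `0 ≤ p ≤ N`. -/
theorem vonMangoldtSum_id_ptAt {p N : ℕ} (hp : p ≤ N) :
    vonMangoldtSum (lin 1 0) (ptAt p) N = ArithmeticFunction.vonMangoldt p := by
  unfold vonMangoldtSum
  rw [filter_ptAt (by omega) (by exact_mod_cast hp), Finset.sum_singleton]
  simp [lin_eval, intVonMangoldt]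

/-- `β_∞(Ψ; {(m)}) = 0`: a point has length zero. -/
theorem archFactor_ptAt {t : ℕ} (Ψ : Fin t → AffLinForm 1) (m : ℤ) : archFactor Ψ (ptAt m) = 0 := by
  unfold archFactor
  rw [ENNReal.toReal_eq_zero_iff]
  left
  refine measure_mono_null (t := Set.Icc (fun _ => (m : ℝ)) (fun _ => (m : ℝ))) ?_ ?_
  · intro x hx
    have hx1 : x = fun _ => (m : ℝ) := by simpa [ptAt] using hx.1
    subst hx1
    simp only [Set.mem_Icc, le_refl, and_self]
  · rw [Real.volume_Icc_pi]
    simp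

/-- The crux with the absolute slack `εN` strengthened to `ε log N`. -/
def RelativeDimOneLogSlack : Prop :=
  ∀ (t L : ℕ), 1 ≤ t → ∀ ε : ℝ, 0 < ε → ∃ N₀ : ℕ, ∀ N : ℕ, N₀ ≤ N →
    ∀ Ψ : Fin t → AffLinForm 1, IsNondegenerateSystem Ψ → affLinSize Ψ N ≤ L →
      ∀ K : Set (Fin 1 → ℝ), Convex ℝ K → K ⊆ realBox 1 N →
        |vonMangoldtSum Ψ K N - archFactor Ψ K * singularProduct Ψ| ≤
          ε * (archFactor Ψ K * singularProduct Ψ + Real.log N)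

/-- **An absolute slack of size `log N` does not suffice** (sharpening of B1): `ψ = n`, `K = {(p)}` with `p`
a prime in `(N/2, N]` (Bertrand): `S = log p > ½ log N` while `β_∞ = 0`, so `|S − 0| ≤ ½ (0 + log N)` fails.
So the minimal absolute slack `g(N)` of a true statement `|S − β_∞𝔖| ≤ ε(β_∞𝔖 + g(N))` lies in
`(log N, N]` (in truth above every `log^A N`, Maier 1985 — not formalised). -/
theorem not_relativeDimOneLogSlack : ¬ RelativeDimOneLogSlack := by
  intro h
  obtain ⟨N₀, hN₀⟩ := h 1 1 le_rfl (1 / 2) (by norm_num)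
  obtain ⟨n, hnN₀, hn4⟩ : ∃ n : ℕ, N₀ ≤ n ∧ 4 ≤ n := ⟨max N₀ 4, le_max_left _ _, le_max_right _ _⟩
  obtain ⟨p, hp, hnp, hp2n⟩ := Nat.exists_prime_lt_and_le_two_mul n (by omega)
  have hN : N₀ ≤ 2 * n := by omega
  have key := hN₀ (2 * n) hN (lin 1 0) (isNondegenerateSystem_lin one_ne_zero 0)
    (by rw [affLinSize_lin]; simp) (ptAt p) (convex_ptAt _)
    (ptAt_subset_realBox (N := 2 * n) (m := p) (by omega) (by exact_mod_cast hp2n))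
  rw [vonMangoldtSum_id_ptAt hp2n, archFactor_ptAt, ArithmeticFunction.vonMangoldt_apply_prime hp] at key
  simp only [zero_mul, sub_zero, zero_add] at key
  -- `log p ≤ ½ log (2n)` contradicts `p² > 2n`
  have hp0 : (0 : ℝ) < p := by exact_mod_cast hp.pos
  have hsq : ((2 * n : ℕ) : ℝ) < (p : ℝ) ^ 2 := by
    have : 2 * n < p * p := by nlinarith
    exact_mod_cast (sq p ▸ this : 2 * n < p ^ 2)
  have hlog : Real.log ((2 * n : ℕ) : ℝ) < 2 * Real.log p := by
    calc Real.log ((2 * n : ℕ) : ℝ) < Real.log ((p : ℝ) ^ 2) :=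
          Real.log_lt_log (by positivity) hsq
      _ = 2 * Real.log p := by rw [Real.log_pow]; norm_num
  rw [abs_of_nonneg (Real.log_nonneg (by exact_mod_cast hp.one_le))] at key
  linarith

end Summit.Parity.GeneralizedHardyLittlewood.Theorems.RelativeDimOne.Negative
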